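import Literature.AnabelianGeometry.EtaleTheta.Discharge.Sec3Prop34iConnectedOfGaloisCovering
import HarnessLib

/-!
# [EtTh] Def 3.3 (iii) / Rmk 3.3.1 at the GENUINE record: primary elements of DISTINCT primes of
# `Φ₀(S) = Hom_G(S, Div⁺(Z^log_∞))` have DISJOINT coordinate supports, and pull-backs `Φ₀(S') → Φ₀(S)` SEPARATE PRIMES

S. Mochizuki, *The étale theta function …*, Publ. RIMS **45** (2009) [MochizukiEtTh2009], Def 3.1 (i) PDF p.70
(`DIV⁺(Z^log_∞) ≅ ∏_{cusps ⊔ components} ℤ≥0`, `Div⁺ ⊆ DIV⁺` Cartier, Prop 3.2 (i): `n · DIV⁺ ⊆ Div⁺`), Def 3.3 (iii)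
p.73 (`Φ₀(Y^log) := lim Div⁺(Z^log_∞)^{Gal(Z^log_∞/Y^log)}`, pull-back functoriality), Rmk 3.3.1 p.73 ("primes of
`Div⁺(Z^log_∞)^{Gal(Z^log_∞/Y^log)}` … = `Gal(Z^log_∞/Y^log)`-orbits of prime log-divisors")
[cite: MochizukiEtTh2009, Rmk 3.3.1 p.73].

abc-iut cell, seat abc-iut-w5-d153 (gen 4).  PROOF-ONLY (theorems only), over abc-iut-w6-d058's genuine pieces
`A.phiZero S`, `A.phiZeroPull f` (`LogDivisorModelGaloisAction.lean`) and abc-iut-L2-t6's coordinates `Z.coord`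
(`LogDivisorModelCoordinates.lean`), all consumed by name:

* bookkeeping in `ℤ`-coordinates (`Z.coord`; the `mult`-forms `mult_le_of_dvd` / `dvd_of_mult_le` / `mem_DIVplus_of_coord_nonneg`
  of abc-iut-w6-d058's `Sec3Prop34iConnectedOfGaloisCovering.lean` are consumed by name): `coord_nonneg_of_mem_DIVplus`,
  `coord_pow`, `coord_le_of_dvd`, `coord_eq_zero_of_precsim`,
  `eq_one_of_forall_coord_eq_zero`, `mem_phiZero_of_coord`, `dvd_of_coord_le` (in `Φ₀(S)`, `w ∣ θ` as soon as `w ≤ θ`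
  coordinatewise — the quotient is Cartier because `Div` is a group, effective by coordinates, equivariant by functoriality);
* **`exists_common_lower_of_coord_ne_zero`** — two members of `Φ₀(S)` with a common support point `(s, x)` have a common
  non-trivial `≼`-lower bound IN `Φ₀(S)`: the `n`-th power (`n` = Prop 3.2 (i)'s exponent) of their pointwise minimum,
  equivariant because `G` acts on `DIV⁺` through its permutation of the prime log-divisors (`mult_act`);
* **`coord_eq_zero_or_of_isPrimary`** — hence primary elements of distinct primes have disjoint coordinate supports
  (Rmk 3.3.1: distinct orbits are disjoint);
* **`phiZeroPull_separatesPrimes`** — for ANY `G`-map `f : S → S'`, the pull-back `Φ₀(f) : Φ₀(S') → Φ₀(S)` separates primes: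
  no non-trivial `d ∈ Φ₀(S)` lies `≼`-below the pull-backs of two primaries of distinct primes (its coordinate support would
  lie in the preimage of two disjoint sets).

This is law (b) of this seat's `Λ = ℝ` reductions of the Def 3.6 (i) binder `hBinj` (`Sec3BLambdaInjectiveOfRlfR(Weak).lean`,
via `RealificationSuppDisjointOfSeparating.lean`) VERIFIED at the genuine record.  HONEST FRAMING: `LogDivisorModel`/`GaloisAction`
are interface/parameter records; elementary coordinate algebra; nothing here bears on [IUTchIII] Cor. 3.12.
-/

noncomputable section

namespace Literature.AnabelianGeometry.EtaleTheta

open CategoryTheory Literature.AlgebraicGeometry.Frobenioids Function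

universe u

namespace LogDivisorModel

variable (Z : LogDivisorModel.{u})

/-- Effective log-divisors have non-negative coordinates. [cite: MochizukiEtTh2009, Def 3.1 p.70] -/
theorem coord_nonneg_of_mem_DIVplus {d : Z.DIV} (hd : d ∈ Z.DIVplus) (x : Z.Idx) : 0 ≤ Z.coord d x := by
  rw [Z.coord_of_mem hd]
  exact Int.natCast_nonneg _

/-- Coordinates of powers. [cite: MochizukiEtTh2009, Def 3.1 p.70] -/
theorem coord_pow (d : Z.DIV) (n : ℕ) (x : Z.Idx) : Z.coord (d ^ n) x = n * Z.coord d x := by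
  induction n with
  | zero => rw [pow_zero, Z.coord_one, Nat.cast_zero, zero_mul]
  | succ n ih => rw [pow_succ, Z.coord_mul, ih, Nat.cast_succ]; ring

/-- Coordinates of `ofMult m`. [cite: MochizukiEtTh2009, Def 3.1 p.70] -/
theorem coord_ofMult (m : Z.Idx → ℕ) (x : Z.Idx) : Z.coord (Z.ofMult m : Z.DIV) x = m x := by
  rw [Z.coord_of_mem (Z.ofMult m).2, Subtype.coe_eta, Z.mult_ofMult]

namespace GaloisAction

variable {Z} {G : Type u} [Group G] (A : Z.GaloisAction G) {S S' : Action (Type u) G}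

/-! ### `Φ₀(S)` in coordinates -/

/-- The values of a member of `Φ₀(S)` are effective. [cite: MochizukiEtTh2009, Def 3.3 p.73] -/
theorem mem_DIVplus_of_mem_phiZero (φ : A.phiZero S) (s : S.V) : φ.1 s ∈ Z.DIVplus :=
  Z.Divplus_le_DIVplus (φ.2.1 s)

/-- Coordinates of members of `Φ₀(S)` are non-negative. [cite: MochizukiEtTh2009, Def 3.3 p.73] -/
theorem coord_phiZero_nonneg (φ : A.phiZero S) (s : S.V) (x : Z.Idx) : 0 ≤ Z.coord (φ.1 s) x :=
  Z.coord_nonneg_of_mem_DIVplus (A.mem_DIVplus_of_mem_phiZero φ s) x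

/-- Coordinates of members of `Φ₀(S)` are equivariant. [cite: MochizukiEtTh2009, Rmk 3.3.1 p.73] -/
theorem coord_phiZero_act (φ : A.phiZero S) (g : G) (s : S.V) (x : Z.Idx) :
    Z.coord (φ.1 (S.ρ g s)) (A.permIdx g x) = Z.coord (φ.1 s) x := by
  rw [φ.2.2 g s, A.coord_act]

/-- Divisibility in `Φ₀(S)` implies `≤` on coordinates. [cite: MochizukiEtTh2009, Def 3.3 p.73] -/
theorem coord_le_of_dvd {φ ψ : A.phiZero S} (h : φ ∣ ψ) (s : S.V) (x : Z.Idx) :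
    Z.coord (φ.1 s) x ≤ Z.coord (ψ.1 s) x := by
  obtain ⟨χ, rfl⟩ := h
  rw [Submonoid.coe_mul, Pi.mul_apply, Z.coord_mul]
  exact le_add_of_nonneg_right (A.coord_phiZero_nonneg χ s x)

/-- `φ ≼ ψ` in `Φ₀(S)` implies: the coordinate support of `φ` lies in that of `ψ`. [cite: MochizukiEtTh2009, Def 3.3 p.73] -/
theorem coord_eq_zero_of_precsim {φ ψ : A.phiZero S} (h : φ ≼ ψ) {s : S.V} {x : Z.Idx}
    (h0 : Z.coord (ψ.1 s) x = 0) : Z.coord (φ.1 s) x = 0 := by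
  obtain ⟨n, -, hdvd⟩ := h
  have h1 := A.coord_le_of_dvd hdvd s x
  rw [SubmonoidClass.coe_pow, Pi.pow_apply, Z.coord_pow, h0, mul_zero] at h1
  exact le_antisymm h1 (A.coord_phiZero_nonneg φ s x)

/-- A member of `Φ₀(S)` with all coordinates zero is trivial. [cite: MochizukiEtTh2009, Def 3.3 p.73] -/
theorem eq_one_of_forall_coord_eq_zero {φ : A.phiZero S} (h : ∀ s x, Z.coord (φ.1 s) x = 0) : φ = 1 :=
  Subtype.ext (funext fun s => Z.eq_one_of_coord_eq_zero (h s))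

/-- **Membership in `Φ₀(S)` from coordinates**: a map `e : S → DIV` with effective Cartier values whose coordinates satisfy
`coord (e (g·s)) (g·x) = coord (e s) x` is `G`-equivariant (the action on `DIV` is through the permutation of the prime
log-divisors), hence lies in `Φ₀(S)`. [cite: MochizukiEtTh2009, Rmk 3.3.1 p.73] -/
theorem mem_phiZero_of_coord (e : S.V → Z.DIV) (hv : ∀ s, e s ∈ Z.Divplus)
    (h : ∀ (g : G) (s : S.V) (x : Z.Idx), Z.coord (e (S.ρ g s)) (A.permIdx g x) = Z.coord (e s) x) :
    e ∈ A.phiZero S := by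
  refine ⟨hv, fun g s => Z.eq_of_coord_eq fun y => ?_⟩
  obtain ⟨x, rfl⟩ := A.permIdx_surjective g y
  rw [h, A.coord_act]

/-- **`w ∣ θ` in `Φ₀(S)` as soon as `w ≤ θ` coordinatewise**: the quotient `θ · w⁻¹` (in the group `DIV`) is Cartier (`Div` is a
subgroup), effective (coordinates) and equivariant (functoriality of the action). [cite: MochizukiEtTh2009, Def 3.3 p.73] -/
theorem dvd_of_coord_le {w θ : A.phiZero S} (h : ∀ s x, Z.coord (w.1 s) x ≤ Z.coord (θ.1 s) x) : w ∣ θ := by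
  let c : S.V → Z.DIV := fun s => θ.1 s * (w.1 s)⁻¹
  have hc : c ∈ A.phiZero S := by
    refine ⟨fun s => ?_, fun g s => ?_⟩
    · refine Submonoid.mem_inf.mpr ⟨?_, ?_⟩
      · exact Z.Div.mul_mem (Z.Divplus_le_Div (θ.2.1 s)) (Z.Div.inv_mem (Z.Divplus_le_Div (w.2.1 s)))
      · refine Z.mem_DIVplus_of_coord_nonneg fun x => ?_
        change 0 ≤ Z.coord (θ.1 s * (w.1 s)⁻¹) x
        rw [Z.coord_mul, Z.coord_inv]
        linarith [h s x]
    · change θ.1 (S.ρ g s) * (w.1 (S.ρ g s))⁻¹ = A.actDIV g (θ.1 s * (w.1 s)⁻¹)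
      rw [θ.2.2 g s, w.2.2 g s, map_mul, map_inv]
  refine ⟨⟨c, hc⟩, Subtype.ext (funext fun s => ?_)⟩
  change θ.1 s = w.1 s * (θ.1 s * (w.1 s)⁻¹)
  rw [mul_comm, inv_mul_cancel_right]

/-! ### Distinct primes have disjoint coordinate supports -/

/-- **Two members of `Φ₀(S)` with a common support point have a common non-trivial `≼`-lower bound in `Φ₀(S)`**: the `n`-th
power of their pointwise minimum (`n` = the exponent of Prop 3.2 (i), making it Cartier-valued), equivariant since `G` acts on
`DIV⁺ ≅ ∏ ℤ≥0` through its permutation of the prime log-divisors. [cite: MochizukiEtTh2009, Rmk 3.3.1 p.73] -/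
theorem exists_common_lower_of_coord_ne_zero (φ ψ : A.phiZero S) {s₀ : S.V} {x₀ : Z.Idx}
    (hφ : Z.coord (φ.1 s₀) x₀ ≠ 0) (hψ : Z.coord (ψ.1 s₀) x₀ ≠ 0) :
    ∃ w : A.phiZero S, w ≠ 1 ∧ w ≼ φ ∧ w ≼ ψ := by
  obtain ⟨n, hn⟩ := Z.exists_pow_mem_Divplus
  -- the pointwise minimum and its `n`-th power
  let m : S.V → Z.Idx → ℕ := fun s x => min (Z.coord (φ.1 s) x).toNat (Z.coord (ψ.1 s) x).toNat
  let wv : S.V → Z.DIV := fun s => ((Z.ofMult (m s) : Z.DIVplus) : Z.DIV) ^ (n : ℕ)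
  have hm : ∀ (g : G) (s : S.V) (x : Z.Idx), m (S.ρ g s) (A.permIdx g x) = m s x := by
    intro g s x
    simp only [m, A.coord_phiZero_act]
  have hwcoord : ∀ s x, Z.coord (wv s) x = n * (m s x : ℤ) := by
    intro s x
    simp only [wv, Z.coord_pow, Z.coord_ofMult]
  have hw : wv ∈ A.phiZero S := by
    refine A.mem_phiZero_of_coord wv (fun s => hn _ (Z.ofMult (m s)).2) fun g s x => ?_
    rw [hwcoord, hwcoord, hm]
  -- coordinates of members of `Φ₀(S)` are the casts of their `toNat`
  have hcast : ∀ (θ : A.phiZero S) (s : S.V) (x : Z.Idx), ((Z.coord (θ.1 s) x).toNat : ℤ) = Z.coord (θ.1 s) x :=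
    fun θ s x => Int.toNat_of_nonneg (A.coord_phiZero_nonneg θ s x)
  have hle : ∀ (θ : A.phiZero S), (∀ s x, m s x ≤ (Z.coord (θ.1 s) x).toNat) → (⟨wv, hw⟩ : A.phiZero S) ≼ θ := by
    intro θ hθ
    refine ⟨n, n.pos, A.dvd_of_coord_le fun s x => ?_⟩
    change Z.coord (wv s) x ≤ Z.coord ((θ ^ (n : ℕ) : A.phiZero S).1 s) x
    rw [hwcoord, SubmonoidClass.coe_pow, Pi.pow_apply, Z.coord_pow, ← hcast θ s x]
    exact mul_le_mul_of_nonneg_left (by exact_mod_cast hθ s x) (Int.natCast_nonneg _)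
  refine ⟨⟨wv, hw⟩, ?_, hle φ (fun s x => min_le_left _ _), hle ψ (fun s x => min_le_right _ _)⟩
  -- non-trivial at `(s₀, x₀)`
  intro h1
  have h2 : Z.coord (wv s₀) x₀ = 0 := by
    have := congrArg (fun θ : A.phiZero S => Z.coord (θ.1 s₀) x₀) h1
    simpa only [Submonoid.coe_one, Pi.one_apply, Z.coord_one] using this
  rw [hwcoord] at h2
  have h3 : (m s₀ x₀ : ℤ) = 0 := by
    rcases mul_eq_zero.mp h2 with h | h
    · exact absurd h (by exact_mod_cast n.pos.ne')
    · exact h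
  have hφ' : 0 < (Z.coord (φ.1 s₀) x₀).toNat := by
    have := A.coord_phiZero_nonneg φ s₀ x₀
    omega
  have hψ' : 0 < (Z.coord (ψ.1 s₀) x₀).toNat := by
    have := A.coord_phiZero_nonneg ψ s₀ x₀
    omega
  have : 0 < m s₀ x₀ := lt_min hφ' hψ'
  omega

/-- **A primary element of `Φ₀(S)` and any member NOT `≼`-above it have disjoint coordinate supports** — in particular primary
elements of DISTINCT primes (Rmk 3.3.1: primes = orbits of prime log-divisors, distinct orbits are disjoint): a common support
point would give a common non-trivial lower bound `w`, and `φ ≼ w ≼ ψ`. [cite: MochizukiEtTh2009, Rmk 3.3.1 p.73] -/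
theorem coord_eq_zero_or_of_isPrimary {φ ψ : A.phiZero S} (hφ : IsPrimary φ) (h : ¬ φ ≼ ψ)
    (s : S.V) (x : Z.Idx) : Z.coord (φ.1 s) x = 0 ∨ Z.coord (ψ.1 s) x = 0 := by
  by_contra hne
  push_cast [not_or] at hne
  obtain ⟨w, hw1, hwφ, hwψ⟩ := A.exists_common_lower_of_coord_ne_zero φ ψ hne.1 hne.2
  exact h ((hφ.2 w hw1 hwφ).trans hwψ)

/-! ### Pull-backs separate primes -/

/-- **The pull-back `Φ₀(f) : Φ₀(S') → Φ₀(S)` along ANY `G`-map `f : S → S'` SEPARATES PRIMES**: for primaries `x₀, y₀` of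
distinct primes of `Φ₀(S')`, no non-trivial `d ∈ Φ₀(S)` lies `≼`-below both `Φ₀(f) x₀` and `Φ₀(f) y₀` — the coordinate support of
`d` would lie in the preimages of two disjoint supports.  This is the hypothesis `hsep` of
`IsPerfFactorialWeak.disjoint_supp_toRealification_map_of_separating` (law (b) of the `Λ = ℝ` reductions of the Def 3.6 (i)
binder `hBinj`) at the genuine Def 3.3 (iii) record. [cite: MochizukiEtTh2009, Rmk 3.3.1 p.73] -/
theorem phiZeroPull_separatesPrimes (f : S ⟶ S') :
    ∀ x₀ y₀ : A.phiZero S', IsPrimary x₀ → IsPrimary y₀ → ¬ x₀ ≼ y₀ →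
      ∀ d : A.phiZero S, d ≼ A.phiZeroPull f x₀ → d ≼ A.phiZeroPull f y₀ → d = 1 := by
  intro x₀ y₀ hx _ hxy d hdx hdy
  refine A.eq_one_of_forall_coord_eq_zero fun s x => ?_
  rcases A.coord_eq_zero_or_of_isPrimary hx hxy (f.hom s) x with h0 | h0
  · exact A.coord_eq_zero_of_precsim hdx (by rw [phiZeroPull_apply]; exact h0)
  · exact A.coord_eq_zero_of_precsim hdy (by rw [phiZeroPull_apply]; exact h0)

end GaloisAction

end LogDivisorModel

end Literature.AnabelianGeometry.EtaleTheta

end
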